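import Summits.CriticalPhenomena.PercolationContinuityZ3.Theorems.PercNearOneGluingNoHeavyLowerTailSahiCombTriWSaturated
import Summits.CriticalPhenomena.PercolationContinuityZ3.Theorems.PercNearOneGluingNoHeavyLowerTailSahiCombTriWCorCoCover
import Summits.CriticalPhenomena.PercolationContinuityZ3.Theorems.PercNearOneGluingNoHeavyLowerTailSahiCombTriWPrincipalCor

/-!
# KLEITMAN SHELLS: Formula A certifies `P` exactly when Kleitman's inequality holds on the shell `P ∪ refl P`

Support file of the one-cut programme (crux `NoHeavyLowerTail`, stmt-CriticalPhenomena-4575; unit `prim-lf-1` gen 41, memo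
`FROM-prim-lf-1-gen41-SHELLS-AND-OR-PRODUCTS.md`).  Continuation of `…SahiCombTriWSaturated` (gen 39: Formula A `κ_A`, its upper sandwich bound
`ptVal_kapA_le_uForm` for EVERY up-set `P`, the lower bound for saturated `P`).

For a region `T ⊆ W = Finset γ` and families `A, B` the KLEITMAN SUM on `T` is `klL T A B = #(T ∩ A ∩ B) − #(T ∩ refl A ∩ B)` (`…TriWAssign`);
Kleitman's antipodal lemma says it is `≥ 0` for `T = W` and up-sets `A, B`.  Call `T` a **Kleitman shell** (`FiveUpSet.KlShell T`) if
`klL T A B ≥ 0` for ALL up-sets `A, B`.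

* `FiveUpSet.ptVal_kapA_sub_lForm` — for EVERY family `P`: `κ_A(A × B) − L_P(A,B) = klL (P ∪ refl P) A B` (the lower sandwich slack of Formula A is the
  Kleitman sum on the shell `P ∪ refl P`; for saturated `P` this is gen 39's Kleitman gap).
* **`FiveUpSet.triW_nonneg_of_shell`** — if `P` is an up-set whose shell `P ∪ refl P` is a Kleitman shell, then `0 ≤ triW P F G` for every index cube and all
  monotone families of up-sets (all `a`): Formula A is a sandwich certificate (`sandwichPt_kapA_of_shell`).
* Shell toolkit: `klShell_univ` (Kleitman), `klShell_empty`, `klShell_union` (disjoint regions add), `klShell_pair` (`{univ, ∅}`),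
  `klShell_of_corP_nonneg` (an antipode-free `P` with `Cor_P ≥ 0` has a Kleitman shell — P5's `corP_eq_card_sub_card_of_disjoint`),
  `klShell_upGen` (principal `↑g`, from `corP_upGen_nonneg`), `klShell_of_saturated`.
The point of the notion: Kleitman shells are closed under OR-PRODUCTS over disjoint coordinate blocks (`…SahiCombTriWOrProduct`, this gen), which
turns every shell family into an infinite hierarchy of new strata of `TriWIneq` (disjoint-generator families `↑g₁ ∪ … ∪ ↑g_k`, `maj ∨ maj`, …).
HONEST LABEL: complete proofs, std axioms; a criterion + toolkit; `TriWIneq` itself stays OPEN (e.g. `K₂₂`, `↑01 ∪ ↑02` have no Kleitman shell). [this work]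
-/

namespace Summit.CriticalPhenomena.PercolationContinuityZ3.Theorems

namespace FiveUpSet

open Finset

variable {β γ : Type} [DecidableEq β] [Fintype β] [DecidableEq γ] [Fintype γ]

/-! ### Kleitman shells -/

/-- A region `T ⊆ W` is a **Kleitman shell** if the Kleitman sum `#(T ∩ A ∩ B) − #(T ∩ refl A ∩ B)` is non-negative for all up-sets `A, B`. [this work] -/
def KlShell (T : Finset (Finset γ)) : Prop :=
  ∀ A B : Finset (Finset γ), IsUpperSet (A : Set (Finset γ)) → IsUpperSet (B : Set (Finset γ)) → 0 ≤ klL T A B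

omit [DecidableEq β] [Fintype β] in
/-- The whole cube is a Kleitman shell (Kleitman's antipodal lemma). [this work] -/
theorem klShell_univ : KlShell (univ : Finset (Finset γ)) := fun A B hA hB => by
  have h := klL_nonneg (P := (univ : Finset (Finset γ))) (by rw [coe_univ]; exact isUpperSet_univ) hA hB
  exact h

omit [DecidableEq β] [Fintype β] in
/-- The empty region is a Kleitman shell. [this work] -/
theorem klShell_empty : KlShell (∅ : Finset (Finset γ)) := fun A B _ _ => by
  unfold klL; simp

omit [DecidableEq β] [Fintype β] in
/-- The Kleitman sum is additive over disjoint regions. [this work] -/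
theorem klL_union_of_disjoint {T₁ T₂ : Finset (Finset γ)} (h : Disjoint T₁ T₂) (A B : Finset (Finset γ)) :
    klL (T₁ ∪ T₂) A B = klL T₁ A B + klL T₂ A B := by
  unfold klL
  rw [union_inter_distrib_right, union_inter_distrib_right, union_inter_distrib_right, union_inter_distrib_right,
    card_union_of_disjoint, card_union_of_disjoint]
  · push_cast; ring
  · exact disjoint_of_subset_left (inter_subset_left.trans inter_subset_left)
      (disjoint_of_subset_right (inter_subset_left.trans inter_subset_left) h)
  · exact disjoint_of_subset_left (inter_subset_left.trans inter_subset_left)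
      (disjoint_of_subset_right (inter_subset_left.trans inter_subset_left) h)

omit [DecidableEq β] [Fintype β] in
/-- Disjoint Kleitman shells add up to a Kleitman shell. [this work] -/
theorem klShell_union {T₁ T₂ : Finset (Finset γ)} (h : Disjoint T₁ T₂) (h₁ : KlShell T₁) (h₂ : KlShell T₂) : KlShell (T₁ ∪ T₂) :=
  fun A B hA hB => by rw [klL_union_of_disjoint h]; exact add_nonneg (h₁ A B hA hB) (h₂ A B hA hB)

omit [DecidableEq β] [Fintype β] in
/-- The Kleitman sum on a region minus a sub-region. [this work] -/
theorem klL_sdiff {T Z : Finset (Finset γ)} (h : Z ⊆ T) (A B : Finset (Finset γ)) :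
    klL (T \ Z) A B = klL T A B - klL Z A B := by
  have hd : Disjoint (T \ Z) Z := sdiff_disjoint
  have := klL_union_of_disjoint hd A B
  rw [sdiff_union_of_subset h] at this
  linarith

omit [DecidableEq β] [Fintype β] in
/-- The two-point region `{univ, ∅}` is a Kleitman shell: its Kleitman sum is `([univ ∈ A] − [∅ ∈ A])·([univ ∈ B] − [∅ ∈ B]) ≥ 0`. [this work] -/
theorem klShell_pair [Nonempty γ] : KlShell ({univ, ∅} : Finset (Finset γ)) := by
  intro A B hA hB
  unfold klL
  have hne : (univ : Finset γ) ≠ ∅ := univ_nonempty.ne_empty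
  -- if `∅ ∈ A` then `A = univ`-family and both counts agree; else `refl A ∌ univ`
  by_cases h0 : (∅ : Finset γ) ∈ A
  · have hAall : ∀ s : Finset γ, s ∈ A := fun s => hA (empty_subset s) h0
    have hrA : ∀ s : Finset γ, s ∈ refl A := fun s => mem_refl.2 (hAall _)
    have e : ({univ, ∅} : Finset (Finset γ)) ∩ refl A ∩ B = ({univ, ∅} : Finset (Finset γ)) ∩ A ∩ B := by
      ext s; simp only [mem_inter]; exact ⟨fun ⟨⟨h1, _⟩, h3⟩ => ⟨⟨h1, hAall s⟩, h3⟩, fun ⟨⟨h1, _⟩, h3⟩ => ⟨⟨h1, hrA s⟩, h3⟩⟩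
    rw [e]; simp
  · -- `refl A ∩ {univ, ∅} ⊆ {∅}` (since `univ ∈ refl A ↔ ∅ ∈ A`), and `∅ ∈ refl A ∩ B → univ ∈ A ∩ B`
    have h1 : ({univ, ∅} : Finset (Finset γ)) ∩ refl A ∩ B ⊆ {∅} := by
      intro s hs
      simp only [mem_inter, mem_insert, mem_singleton] at hs
      rcases hs.1.1 with rfl | rfl
      · exact absurd (by simpa [mem_refl] using hs.1.2) h0
      · exact mem_singleton.2 rfl
    by_cases hB0 : (∅ : Finset γ) ∈ refl A ∩ B
    · -- then `univ ∈ A` and `∅ ∈ B`, so `univ ∈ {univ,∅} ∩ A ∩ B`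
      have hu : (univ : Finset γ) ∈ ({univ, ∅} : Finset (Finset γ)) ∩ A ∩ B := by
        rw [mem_inter] at hB0
        have hUA : (univ : Finset γ) ∈ A := by simpa [mem_refl] using hB0.1
        have hUB : (univ : Finset γ) ∈ B := hB (empty_subset _) hB0.2
        simp [hUA, hUB]
      have c1 : (({univ, ∅} : Finset (Finset γ)) ∩ refl A ∩ B).card ≤ 1 :=
        (card_le_card h1).trans (card_singleton _).le
      have c2 : 1 ≤ (({univ, ∅} : Finset (Finset γ)) ∩ A ∩ B).card := card_pos.2 ⟨_, hu⟩
      omega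
    · have e : ({univ, ∅} : Finset (Finset γ)) ∩ refl A ∩ B = ∅ := by
        apply eq_empty_of_forall_notMem
        intro s hs
        have hs' := h1 hs
        rw [mem_singleton] at hs'
        rw [hs', mem_inter, mem_inter] at hs
        exact hB0 (mem_inter.2 ⟨hs.1.2, hs.2⟩)
      rw [e]; simp

omit [DecidableEq β] [Fintype β] in
/-- **An antipode-free family with `Cor_P ≥ 0` has a Kleitman shell** (P5 g24 `corP_eq_card_sub_card_of_disjoint`: for `Disjoint P (refl P)`,
`Cor_P(A,B) = klL (P ∪ refl P) A B`). [this work] -/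
theorem klShell_of_corP_nonneg {P : Finset (Finset γ)} (hP : Disjoint P (refl P))
    (hcor : ∀ A B : Finset (Finset γ), IsUpperSet (A : Set (Finset γ)) → IsUpperSet (B : Set (Finset γ)) → 0 ≤ corP P A B) :
    KlShell (P ∪ refl P) := by
  intro A B hA hB
  have h := hcor A B hA hB
  rw [corP_eq_card_sub_card_of_disjoint hP] at h
  unfold klL
  exact h

omit [DecidableEq β] [Fintype β] in
/-- A principal up-set is antipode free: `Disjoint (↑g) (refl ↑g)` for `g ≠ ∅`. [this work] -/
theorem disjoint_upGen_refl {g : Finset γ} (hg : g.Nonempty) : Disjoint (upGen g) (refl (upGen g)) := by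
  rw [disjoint_left]
  intro t ht hrt
  rw [mem_refl] at hrt
  simp only [upGen, mem_filter, mem_univ, true_and] at ht hrt
  obtain ⟨i, hi⟩ := hg
  exact (mem_compl.1 (hrt hi)) (ht hi)

omit [DecidableEq β] [Fintype β] in
/-- **The shell of a principal up-set `↑g` (`g ≠ ∅`) is a Kleitman shell** (gen 40 `corP_upGen_nonneg`). [this work] -/
theorem klShell_upGen {g : Finset γ} (hg : g.Nonempty) : KlShell (upGen g ∪ refl (upGen g)) :=
  klShell_of_corP_nonneg (disjoint_upGen_refl hg) fun _ _ hA hB => corP_upGen_nonneg g hA hB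

omit [DecidableEq β] [Fintype β] in
/-- A saturated family (`P ∪ refl P = univ`) has a Kleitman shell. [this work] -/
theorem klShell_of_saturated {P : Finset (Finset γ)} (hsat : ∀ e : Finset γ, e ∈ P ∨ eᶜ ∈ P) : KlShell (P ∪ refl P) := by
  have e : P ∪ refl P = univ := by
    apply eq_univ_of_forall
    intro s
    rcases hsat s with h | h
    · exact mem_union_left _ h
    · exact mem_union_right _ (mem_refl.2 h)
  rw [e]; exact klShell_univ

/-! ### Formula A: the lower slack is the Kleitman sum on the shell -/

omit [DecidableEq β] [Fintype β] in
/-- **For EVERY family `P`: `κ_A(A × B) − L_P(A,B) = klL (P ∪ refl P) A B`.** [this work] -/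
theorem ptVal_kapA_sub_lForm (P A B : Finset (Finset γ)) :
    ptVal (kapA P) A B - lForm P A B = klL (P ∪ refl P) A B := by
  rw [ptVal_kapA]
  unfold lForm klL
  -- antipodal images: `#(P ∩ refl P ∩ A ∩ refl B) = #(P ∩ refl P ∩ refl A ∩ B)`, `#(P ∩ A ∩ refl B) = #(refl P ∩ refl A ∩ B)`
  have r1 : (P ∩ refl P ∩ A ∩ refl B).card = (P ∩ refl P ∩ refl A ∩ B).card := by
    rw [← card_refl (P ∩ refl P ∩ A ∩ refl B), refl_inter, refl_inter, refl_inter, refl_refl, refl_refl, inter_comm (refl P) P]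
  have r2 : (P ∩ A ∩ refl B).card = (refl P ∩ refl A ∩ B).card := by
    rw [← card_refl (P ∩ A ∩ refl B), refl_inter, refl_inter, refl_refl]
  -- decompositions of the shell counts
  have c1 : ((P ∪ refl P) ∩ A ∩ B).card = ((P \ refl P) ∩ A ∩ B).card + (refl P ∩ A ∩ B).card := by
    rw [← card_union_of_disjoint]
    · congr 1; ext s; simp only [mem_inter, mem_union, mem_sdiff]; tauto
    · rw [disjoint_left]; intro s h1 h2
      simp only [mem_inter, mem_sdiff] at h1 h2; exact h1.1.1.2 h2.1.1
  have c2 : ((P ∪ refl P) ∩ refl A ∩ B).card + (P ∩ refl P ∩ refl A ∩ B).card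
      = (P ∩ refl A ∩ B).card + (refl P ∩ refl A ∩ B).card := by
    have hu : P ∩ refl A ∩ B ∪ refl P ∩ refl A ∩ B = (P ∪ refl P) ∩ refl A ∩ B := by
      ext s; simp only [mem_union, mem_inter]; tauto
    have hi : P ∩ refl A ∩ B ∩ (refl P ∩ refl A ∩ B) = P ∩ refl P ∩ refl A ∩ B := by
      ext s; simp only [mem_inter]; tauto
    have := card_union_add_card_inter (P ∩ refl A ∩ B) (refl P ∩ refl A ∩ B)
    rw [hu, hi] at this
    omega
  rw [r1, r2]
  have c1' : (((P ∪ refl P) ∩ A ∩ B).card : ℤ) = ((P \ refl P) ∩ A ∩ B).card + (refl P ∩ A ∩ B).card := by exact_mod_cast c1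
  have c2' : (((P ∪ refl P) ∩ refl A ∩ B).card : ℤ) + (P ∩ refl P ∩ refl A ∩ B).card
      = (P ∩ refl A ∩ B).card + (refl P ∩ refl A ∩ B).card := by exact_mod_cast c2
  linarith

omit [DecidableEq β] [Fintype β] in
/-- **Formula A is a sandwich certificate for every up-set with a Kleitman shell.** [this work] -/
theorem sandwichPt_kapA_of_shell {P : Finset (Finset γ)} (hP : IsUpperSet (P : Set (Finset γ))) (hT : KlShell (P ∪ refl P)) :
    SandwichPt P 1 (kapA P) := by
  intro A B hA hB
  refine ⟨?_, ?_⟩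
  · rw [Nat.cast_one, one_mul]
    have h1 := ptVal_kapA_sub_lForm P A B
    have h2 := hT A B hA hB
    linarith
  · rw [Nat.cast_one, one_mul]; exact ptVal_kapA_le_uForm hP hA hB

/-- **`TriWIneq` on the SHELL stratum**: an up-set `P` whose shell `P ∪ refl P` is a Kleitman shell satisfies `0 ≤ triW P F G` for EVERY index cube
`Finset β` and all monotone families of up-sets `F, G`. [this work] -/
theorem triW_nonneg_of_shell {P : Finset (Finset γ)} (hP : IsUpperSet (P : Set (Finset γ))) (hT : KlShell (P ∪ refl P))
    (F G : Finset β → Finset (Finset γ))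
    (hF : ∀ x, IsUpperSet (F x : Set (Finset γ))) (hG : ∀ x, IsUpperSet (G x : Set (Finset γ)))
    (hFm : Monotone F) (hGm : Monotone G) :
    0 ≤ triW P F G :=
  triW_nonneg_of_sandwichPt Nat.one_pos (sandwichPt_kapA_of_shell hP hT) F G hF hG hFm hGm

omit [DecidableEq β] [Fintype β] in
/-- Conversely, the shell condition is exactly what Formula A needs: if `κ_A` is a sandwich certificate (with `c = 1`) then `P ∪ refl P` is a Kleitman shell. [this work] -/
theorem klShell_of_sandwichPt_kapA {P : Finset (Finset γ)} (h : SandwichPt P 1 (kapA P)) : KlShell (P ∪ refl P) := by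
  intro A B hA hB
  have h1 := (h A B hA hB).1
  rw [Nat.cast_one, one_mul] at h1
  have h2 := ptVal_kapA_sub_lForm P A B
  linarith

end FiveUpSet

end Summit.CriticalPhenomena.PercolationContinuityZ3.Theorems
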